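import Summits.AtomisticToContinuum.HydrodynamicLimit.Theorems.AntiMazurCoboundariesCellForecastPressureDecayContactStatisticsExpansion
import Summits.AtomisticToContinuum.HydrodynamicLimit.Theorems.AntiMazurCoboundariesCellForecastPressureDecayContactStatisticsLayer
import Summits.AtomisticToContinuum.HydrodynamicLimit.Theorems.AntiMazurCoboundariesCellForecastPressureDecayContactStatisticsSum
import Summits.AtomisticToContinuum.HydrodynamicLimit.Theorems.AntiMazurCoboundariesCellForecastPressureDecayContactStatisticsReduction
import HarnessLib

/-!
# S2c · near-contact pair statistics of the canonical cell (stub `stub_contactStatistics` of the crux line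
# `enskog-compensator-martingale`, crux `CellForecastPressureDecay`, stmt-AtomisticToContinuum-13915)

`ContactStatistics σ`: for `0 < σ ≤ 3/16`, `L ≥ L₀`, `n ≤ 2L³` there is ONE constant `c₂ ≥ 0` such that for every
measurable `|φ| ≤ 1` supported in the contact shell `σ ≤ ‖q‖ ≤ σ + r`, `r ≤ 1`,
`|∑_{i≠j} E φ(xᵢ − xⱼ) − c₂ ∫ φ| ≤ C (r L² + r² L³)` under the uniform hard-core position law of the cell `[0,L]³`.

Proof (the closing file of the stub; all pieces are companion files of the line):
* § 1 **weak isotropy of the pair law** (`weakIsotropy_posLaw`): for `i ≠ j`, a linear isometry `g` and a measurable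
  `|ψ| ≤ 1` supported in `‖q‖ ≤ σ + 3`, `|E ψ(xᵢ − xⱼ) − E ψ(g(xᵢ − xⱼ))| ≤ (K/L⁴) ∫|ψ|`. The position law is the
  power of the uniform law on the cube conditioned on the hard core (`posLaw_eq_cond_pi`), so the difference is
  `Ξ⁻¹ ∫ Δ(xᵢ,xⱼ) 𝟙[hard core]` with `Δ = ψ(· − ·) − ψ(g(· − ·))`; expand in clusters with the two marked particles
  (`…Expansion`); every bracket reduces to its boundary layer (`…Layer`: bulk invariance under the recentred
  isometry `…Bulk`, boundary-layer tree bounds `…Brackets`/`…TreeBound`/`…Tail`); sum the geometric series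
  (`…Sum`, sharp insertion ratio and tree sums of `…Tail`) — convergent since `n p ≤ (8π/3)σ³ ≤ 1/14`.
* § 2 the registered stub: `ContactStatistics σ` from `ContactLayerBounds σ` and § 1 by the reduction
  (`…Reduction`: ghost-sphere representation `…Ghost`, moving the ghost, averaging over rotations `…Averaging`).

References: E. Pulvirenti, D. Tsagkarogiannis, Comm. Math. Phys. 316 (2012) 289–306 (canonical cluster
expansion); D. Ruelle, *Statistical Mechanics: Rigorous Results* (1969), §4.2; J.-P. Hansen, I. R. McDonald,
*Theory of Simple Liquids* (2013), §2.5 (pair distribution at contact).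
-/

noncomputable section

open MeasureTheory ProbabilityTheory Set Filter
open scoped ENNReal BigOperators
open Literature.Analysis.FluidPDE Literature.MathematicalPhysics.KineticTheory
open Literature.MathematicalPhysics.StatisticalMechanics
open Literature.Probability.LatticeModels (treeNumber)
open Summit.AtomisticToContinuum.HydrodynamicLimit.Theorems.CellForecastPressureDecay
  (cellCube measurableSet_cellCube volume_cellCube)

namespace Summit.AtomisticToContinuum.HydrodynamicLimit.Theorems.EnskogCompensator

/-! ## § 1 The weak isotropy of the pair law -/

/-- **Expectations under the position law are normalised hard-core integrals**: for a measurable `f`,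
`∫ f dposLaw = Ξ⁻¹ ∫ f 𝟙[hard core] dν^{⊗n}`, `ν` the uniform law on the cube, `Ξ = ν^{⊗n}(hard core) > 0`. [folklore] -/
theorem integral_posLaw_eq_hardCore (σ L : ℝ) (n : ℕ) {f : (Fin n → V3) → ℝ} :
    ∫ x, f x ∂(posLaw σ L n) =
      (hcProb (fun y y' : V3 => ‖y - y'‖ < σ) (volume[|cellCube L]) (Finset.univ : Finset (Fin n)))⁻¹ *
        ∫ x, f x * efR (fun y y' : V3 => ‖y - y'‖ < σ) x Finset.univ
          ∂(Measure.pi fun _ : Fin n => volume[|cellCube L]) := by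
  have hH := measurableSet_hardCoreSet (ι := Fin n) (O := fun y y' : V3 => ‖y - y'‖ < σ) (measurableSet_overlap_lt σ)
    (Finset.univ : Finset (Fin n))
  rw [posLaw_eq_cond_pi, ProbabilityTheory.cond, integral_smul_measure, ← integral_indicator hH, hcProb,
    measureReal_def, ← ENNReal.toReal_inv, smul_eq_mul]
  congr 1
  refine integral_congr_ae (Eventually.of_forall fun x => ?_)
  show (hardCoreSet (fun y y' : V3 => ‖y - y'‖ < σ) (Finset.univ : Finset (Fin n))).indicator f x =
    f x * efR (fun y y' : V3 => ‖y - y'‖ < σ) x Finset.univ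
  rw [efR_eq_indicator]
  by_cases hx : x ∈ hardCoreSet (fun y y' : V3 => ‖y - y'‖ < σ) (Finset.univ : Finset (Fin n))
  · rw [Set.indicator_of_mem hx, Set.indicator_of_mem hx, Pi.one_apply, mul_one]
  · rw [Set.indicator_of_notMem hx, Set.indicator_of_notMem hx, mul_zero]

/-- The packing parameter of the line: `n · vol B(0,σ)/L³ ≤ 1/14` for `σ ≤ 3/16`, `n ≤ 2L³`. [folklore] -/
theorem card_mul_ballMass_le {σ L : ℝ} (hσ : 0 < σ) (hσ' : σ ≤ 3 / 16) (hL : 0 < L) {n : ℕ}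
    (hn : (n : ℝ) ≤ 2 * L ^ 3) : (n : ℝ) * ((L ^ 3)⁻¹ * (σ ^ 3 * (Real.pi * 4 / 3))) ≤ 1 / 14 := by
  have hnL : (n : ℝ) * (L ^ 3)⁻¹ ≤ 2 := by
    rw [← div_eq_mul_inv, div_le_iff₀ (pow_pos hL 3)]; exact hn
  have hσ3 : σ ^ 3 ≤ (3 / 16) ^ 3 := pow_le_pow_left₀ hσ.le hσ' 3
  have hπ : Real.pi * 4 / 3 ≤ 16 / 3 := by linarith [Real.pi_le_four]
  calc (n : ℝ) * ((L ^ 3)⁻¹ * (σ ^ 3 * (Real.pi * 4 / 3)))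
      = ((n : ℝ) * (L ^ 3)⁻¹) * (σ ^ 3 * (Real.pi * 4 / 3)) := by ring
    _ ≤ 2 * ((3 / 16) ^ 3 * (16 / 3)) :=
        mul_le_mul hnL (mul_le_mul hσ3 hπ (by positivity) (by positivity)) (by positivity) zero_le_two
    _ ≤ 1 / 14 := by norm_num

/-- **Weak isotropy of the pair law of the cell.** For `0 < σ ≤ 3/16` there is `K` such that for `L ≥ 1`,
`n ≤ 2L³`, `i ≠ j`, every linear isometry `g` of `ℝ³` and every measurable `|ψ| ≤ 1` supported in `‖q‖ ≤ σ + 3`,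
`|E ψ(xᵢ − xⱼ) − E ψ(g(xᵢ − xⱼ))| ≤ (K/L⁴) ∫|ψ|` under the uniform hard-core position law: two-marked cluster
expansion of `Ξ⁻¹ ∫ Δ 𝟙[hard core]`, brackets reduced to their boundary layers by the bulk invariance, geometric
summation. [cite: PulvirentiTsagkarogiannis2012, §3] -/
theorem weakIsotropy_posLaw {σ : ℝ} (hσ : 0 < σ) (hσ' : σ ≤ 3 / 16) :
    ∃ K : ℝ, 0 ≤ K ∧ ∃ L₁ : ℝ, 1 ≤ L₁ ∧ ∀ L : ℝ, L₁ ≤ L → ∀ n : ℕ, (n : ℝ) ≤ 2 * L ^ 3 →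
      ∀ i j : Fin n, i ≠ j → ∀ g : V3 ≃ₗᵢ[ℝ] V3, ∀ ψ : V3 → ℝ, Measurable ψ → (∀ q, |ψ q| ≤ 1) →
        (∀ q, ψ q ≠ 0 → ‖q‖ ≤ σ + 3) →
          |(∫ x, ψ (x i - x j) ∂(posLaw σ L n)) - ∫ x, ψ (g (x i - x j)) ∂(posLaw σ L n)| ≤
            K / L ^ 4 * ∫ q, |ψ q| := by
  set a : ℝ := 14 / 13 with ha
  refine ⟨12 * (2 * a) ^ 2 * (Real.exp 1 * Real.exp 1) * (2 * σ + 3), by positivity, 1, le_rfl,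
    fun L hL n hn i j hij g ψ hψm hψ1 hψs => ?_⟩
  have hL0 : 0 < L := by linarith
  obtain ⟨m, rfl⟩ : ∃ m, n = m + 1 := ⟨n - 1, by have := i.pos; omega⟩
  haveI := isProbabilityMeasure_cond_cellCube hL0
  have hO := measurableSet_overlap_lt σ
  have hOs : ∀ a b : V3, (fun y y' : V3 => ‖y - y'‖ < σ) a b → (fun y y' : V3 => ‖y - y'‖ < σ) b a :=
    fun a b h => by simpa [norm_sub_rev] using h
  have hI0 : 0 ≤ ∫ q, |ψ q| := integral_nonneg fun q => abs_nonneg _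
  have hRHS : 0 ≤ 12 * (2 * a) ^ 2 * (Real.exp 1 * Real.exp 1) * (2 * σ + 3) / L ^ 4 * ∫ q, |ψ q| := by positivity
  set Ξ : ℝ := hcProb (fun y y' : V3 => ‖y - y'‖ < σ) (volume[|cellCube L]) (Finset.univ : Finset (Fin (m + 1)))
    with hΞdef
  -- the hard core has positive probability, or everything vanishes
  rcases eq_or_lt_of_le (hcProb_nonneg (O := fun y y' : V3 => ‖y - y'‖ < σ) (volume[|cellCube L])
    (Finset.univ : Finset (Fin (m + 1)))) with hΞ0 | hΞpos
  · have hzero : posLaw σ L (m + 1) = 0 := by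
      have h0 := hΞ0.symm
      rw [hcProb, measureReal_def, ENNReal.toReal_eq_zero_iff] at h0
      rw [posLaw_eq_cond_pi, ProbabilityTheory.cond, Measure.restrict_eq_zero.2 (h0.resolve_right (measure_ne_top _ _)),
        smul_zero]
    rw [hzero, integral_zero_measure, integral_zero_measure, sub_zero, abs_zero]
    exact hRHS
  -- normalise and expand
  have hf1 : Measurable fun x : Fin (m + 1) → V3 => ψ (x i - x j) :=
    hψm.comp ((measurable_pi_apply i).sub (measurable_pi_apply j))
  have hf2 : Measurable fun x : Fin (m + 1) → V3 => ψ (g (x i - x j)) :=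
    hψm.comp (g.continuous.measurable.comp ((measurable_pi_apply i).sub (measurable_pi_apply j)))
  have hint : ∀ (f : (Fin (m + 1) → V3) → ℝ), Measurable f → (∀ x, |f x| ≤ 1) →
      Integrable (fun x => f x * efR (fun y y' : V3 => ‖y - y'‖ < σ) x Finset.univ)
        (Measure.pi fun _ : Fin (m + 1) => volume[|cellCube L]) := fun f hf hfb =>
    integrable_pi_of_bounded _ (hf.mul (measurable_efR hO _)) (C := 1 * 1) fun x => by
      rw [abs_mul]; exact mul_le_mul (hfb x) (abs_efR_le_one x _) (abs_nonneg _) zero_le_one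
  have hΔ : Measurable fun q : V3 × V3 => ψ (q.1 - q.2) - ψ (g (q.1 - q.2)) :=
    (hψm.comp (measurable_fst.sub measurable_snd)).sub
      (hψm.comp (g.continuous.measurable.comp (measurable_fst.sub measurable_snd)))
  have hΔb : ∀ a b : V3, |ψ (a - b) - ψ (g (a - b))| ≤ 2 := fun a b =>
    (abs_sub _ _).trans (by linarith [hψ1 (a - b), hψ1 (g (a - b))])
  have h1 : Integrable (fun x : Fin (m + 1) → V3 => ψ (x i - x j) * efR (fun y y' : V3 => ‖y - y'‖ < σ) x Finset.univ)
      (Measure.pi fun _ : Fin (m + 1) => volume[|cellCube L]) := hint _ hf1 fun x => hψ1 _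
  have h2 : Integrable (fun x : Fin (m + 1) → V3 => ψ (g (x i - x j)) * efR (fun y y' : V3 => ‖y - y'‖ < σ) x Finset.univ)
      (Measure.pi fun _ : Fin (m + 1) => volume[|cellCube L]) := hint _ hf2 fun x => hψ1 _
  have e1 := integral_posLaw_eq_hardCore σ L (m + 1) (f := fun x => ψ (x i - x j))
  have e2 := integral_posLaw_eq_hardCore σ L (m + 1) (f := fun x => ψ (g (x i - x j)))
  have e3 : (∫ x, ψ (x i - x j) * efR (fun y y' : V3 => ‖y - y'‖ < σ) x Finset.univ
        ∂(Measure.pi fun _ : Fin (m + 1) => volume[|cellCube L])) -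
      ∫ x, ψ (g (x i - x j)) * efR (fun y y' : V3 => ‖y - y'‖ < σ) x Finset.univ
        ∂(Measure.pi fun _ : Fin (m + 1) => volume[|cellCube L]) =
      ∫ x, (ψ (x i - x j) - ψ (g (x i - x j))) * efR (fun y y' : V3 => ‖y - y'‖ < σ) x Finset.univ
        ∂(Measure.pi fun _ : Fin (m + 1) => volume[|cellCube L]) := by
    rw [← integral_sub h1 h2]
    exact integral_congr_ae (Eventually.of_forall fun x => by ring)
  have e4 := integral_mul₂_efR_eq_sum (O := fun y y' : V3 => ‖y - y'‖ < σ) (volume[|cellCube L]) hO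
    (Finset.mem_univ i) (Finset.mem_univ j) (Φ := fun a b => ψ (a - b) - ψ (g (a - b))) hΔ hΔb
  rw [e1, e2, ← mul_sub, e3, e4, abs_mul, abs_inv, abs_of_pos hΞpos]
  -- the parameters of the summation
  set p : ℝ := (L ^ 3)⁻¹ * (σ ^ 3 * (Real.pi * 4 / 3)) with hpdef
  have hp0 : 0 ≤ p := by positivity
  have hp : ∀ z, volume[|cellCube L] {y | (fun y y' : V3 => ‖y - y'‖ < σ) z y} ≤ ENNReal.ofReal p :=
    fun z => cond_cellCube_ball_le hL0 hσ.le z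
  have hnp : ((m + 1 : ℕ) : ℝ) * p ≤ 1 / 14 := card_mul_ballMass_le hσ hσ' hL0 hn
  have hθ : 13 / 14 ≤ 1 - ((m + 1 : ℕ) : ℝ) * p := by linarith
  have hθpos : 0 < 1 - ((m + 1 : ℕ) : ℝ) * p := by linarith
  have ha0 : 0 ≤ a := by norm_num
  have hainv : (1 - ((m + 1 : ℕ) : ℝ) * p)⁻¹ ≤ a := by
    rw [ha, inv_le_comm₀ hθpos (by norm_num), show ((14 : ℝ) / 13)⁻¹ = 13 / 14 by norm_num]
    exact hθ
  have hratio : ∀ B : Finset (Fin (m + 1)),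
      hcProb (fun y y' : V3 => ‖y - y'‖ < σ) (volume[|cellCube L]) (Finset.univ \ B) ≤ a ^ B.card * Ξ := by
    intro B
    have h := stub_contactStatistics_tail.1 (m + 1) (volume[|cellCube L]) (fun y y' : V3 => ‖y - y'‖ < σ) hO hOs p
      hp0 hp (by linarith) B
    have hθk : 0 < (1 - ((m + 1 : ℕ) : ℝ) * p) ^ B.card := pow_pos hθpos _
    calc hcProb (fun y y' : V3 => ‖y - y'‖ < σ) (volume[|cellCube L]) (Finset.univ \ B)
        ≤ Ξ / (1 - ((m + 1 : ℕ) : ℝ) * p) ^ B.card := by rw [le_div_iff₀ hθk]; exact h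
      _ = ((1 - ((m + 1 : ℕ) : ℝ) * p)⁻¹) ^ B.card * Ξ := by rw [inv_pow, div_eq_mul_inv, mul_comm]
      _ ≤ a ^ B.card * Ξ :=
          mul_le_mul_of_nonneg_right (pow_le_pow_left₀ (inv_nonneg.2 hθpos.le) hainv _) hΞpos.le
  have hcond : 2 * Real.exp 1 * (2 * a * p) * ((m + 1 : ℕ) : ℝ) ≤ 1 := by
    have he := Real.exp_one_lt_d9
    have he0 := (Real.exp_pos 1).le
    calc 2 * Real.exp 1 * (2 * a * p) * ((m + 1 : ℕ) : ℝ) = 4 * a * Real.exp 1 * (((m + 1 : ℕ) : ℝ) * p) := by ring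
      _ ≤ 4 * a * 2.7182818286 * (1 / 14) :=
          mul_le_mul (mul_le_mul_of_nonneg_left he.le (by positivity)) hnp (by positivity) (by positivity)
      _ ≤ 1 := by rw [ha]; norm_num
  have hsum := abs_clusterSum_le hij hσ.le hL0 (s := (L ^ 3)⁻¹ * (2 * ∫ q, |ψ q|)) (by positivity) hp0 ha0 hcond
    (hcProb (fun y y' : V3 => ‖y - y'‖ < σ) (volume[|cellCube L]))
    (fun W => hcProb_nonneg _ W) hratio
    (fun B => ∫ x, (ψ (x i - x j) - ψ (g (x i - x j))) * uR (fun y y' : V3 => ‖y - y'‖ < σ) x B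
      ∂(Measure.pi fun _ : Fin (m + 1) => volume[|cellCube L]))
    (fun B B' => ∫ x, (ψ (x i - x j) - ψ (g (x i - x j))) *
      (uR (fun y y' : V3 => ‖y - y'‖ < σ) x B * uR (fun y y' : V3 => ‖y - y'‖ < σ) x B')
      ∂(Measure.pi fun _ : Fin (m + 1) => volume[|cellCube L]))
    (fun B hB => by
      simp only [Finset.mem_filter, Finset.mem_powerset] at hB
      exact abs_bracket₁_le hσ hL0 hψm hψ1 hψs g hB.1.2 hB.2 hij)
    (fun B hB B' hB' => by
      simp only [Finset.mem_filter, Finset.mem_powerset] at hB hB'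
      exact abs_bracket₂_le hσ hL0 hψm hψ1 hψs g hB.1.2 hB'.2 hB'.1)
  calc Ξ⁻¹ * |(∑ B ∈ ((Finset.univ : Finset (Fin (m + 1))).powerset.filter (fun B => i ∈ B)).filter (fun B => j ∈ B),
          (∫ x, (ψ (x i - x j) - ψ (g (x i - x j))) * uR (fun y y' : V3 => ‖y - y'‖ < σ) x B
            ∂(Measure.pi fun _ : Fin (m + 1) => volume[|cellCube L])) *
            hcProb (fun y y' : V3 => ‖y - y'‖ < σ) (volume[|cellCube L]) (Finset.univ \ B)) +
        ∑ B ∈ ((Finset.univ : Finset (Fin (m + 1))).powerset.filter (fun B => i ∈ B)).filter (fun B => j ∉ B),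
          ∑ B' ∈ (Finset.univ \ B).powerset.filter (fun B' => j ∈ B'),
            (∫ x, (ψ (x i - x j) - ψ (g (x i - x j))) *
              (uR (fun y y' : V3 => ‖y - y'‖ < σ) x B * uR (fun y y' : V3 => ‖y - y'‖ < σ) x B')
              ∂(Measure.pi fun _ : Fin (m + 1) => volume[|cellCube L])) *
              hcProb (fun y y' : V3 => ‖y - y'‖ < σ) (volume[|cellCube L]) ((Finset.univ \ B) \ B')|
      ≤ Ξ⁻¹ * (Ξ * (6 * ((L ^ 3)⁻¹ * (2 * ∫ q, |ψ q|)) / L * (2 * σ + 3) * (2 * a) ^ 2 *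
          (Real.exp 1 * Real.exp 1))) :=
        mul_le_mul_of_nonneg_left hsum (inv_nonneg.2 hΞpos.le)
    _ = 12 * (2 * a) ^ 2 * (Real.exp 1 * Real.exp 1) * (2 * σ + 3) / L ^ 4 * ∫ q, |ψ q| := by
        have hΞne : Ξ ≠ 0 := hΞpos.ne'
        have hLne : L ≠ 0 := hL0.ne'
        field_simp
        ring

/-! ## § 2 The registered stub -/

/-- **S2c · near-contact pair statistics** (registered stub `stub_contactStatistics` of the line
`enskog-compensator-martingale`): for `0 < σ ≤ 3/16` (granted the factorisation of the cell law, unused, and the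
contact-layer bounds), `ContactStatistics σ`: for `L ≥ L₀`, `n ≤ 2L³` there is ONE constant `c₂ ≥ 0`
(`= n(n−1)(Z_{n−1}/Z_n)` times the fitting probability of a ghost sphere at contact in a reference direction) such that
for every measurable `|φ| ≤ 1` supported in the shell `σ ≤ ‖q‖ ≤ σ + r`, `r ≤ 1`,
`|∑_{i≠j} E φ(xᵢ − xⱼ) − c₂ ∫φ| ≤ C (r L² + r² L³)` — the weak isotropy of the pair law (§ 1, cluster expansion) fed
into the ghost-sphere reduction. [cite: PulvirentiTsagkarogiannis2012, §3] -/
theorem stub_contactStatistics : ∀ σ : ℝ, 0 < σ → σ ≤ 3 / 16 → CellLawFactorises σ → ContactLayerBounds σ → ContactStatistics σ :=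
  fun σ hσ hσ' _ hCLB => stub_contactStatistics_reduction σ hσ hσ' hCLB (weakIsotropy_posLaw hσ hσ')

end Summit.AtomisticToContinuum.HydrodynamicLimit.Theorems.EnskogCompensator

end
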